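import Summits.SmoothPoincare4.SmoothPoincare4.Theses.EntropyRung
import Summits.SmoothPoincare4.SmoothPoincare4.Theorems.EntropyRungSubcylindricalExistenceEntropyLocalisation
import HarnessLib

/-!
# Localisation of Perelman's `𝒲`-functional under a finite partition `Σᵢ χᵢ² = 1`
(helper `helper_localisationFinite` for line `fat-conical-core-avr-logsobolev`, crux
`EntropyRung.SubcylindricalExistence`, item stmt-SmoothPoincare4-10871)

The `n`-piece version of the landed two-piece lemma `wEntropy_localisation_two`
(`Theorems/EntropyRungSubcylindricalExistenceEntropyLocalisation.lean`). For a smooth Riemannian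
metric `g` (Levi-Civita connection) on a closed 4-manifold of the summit binder, `τ > 0`,
`c = (4πτ)⁻²`, a finite family of smooth functions `χ : Fin n → (M → ℝ)` with `Σᵢ χᵢ² = 1` and a
smooth `w` with `∫ c w² dV = 1`, writing `𝒲(v) = ∫ [τ (R v² + 4|∇v|²) − v² log v² − 4 v²] c dV`
and `mᵢ = ∫ c w² χᵢ² dV`, we prove
`Σᵢ 𝒲(χᵢ w) + Σᵢ mᵢ log mᵢ − 4τ ∫ c w² (Σᵢ |∇χᵢ|²) dV ≤ 𝒲(w)` (`helper_localisationFinite`).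
Ingredients: the finite IMS formula `Σᵢ |∇(χᵢ w)|² = |∇w|² + w² Σᵢ |∇χᵢ|²`
(`gradSq_localisation_sum`, from `Σᵢ χᵢ dχᵢ = 0`, `dcov_partition_sum`), the pointwise splitting
`(χ w)² log (χ w)² = χ² (w² log w²) + w² (χ² log χ²)` and Jensen's inequality for `s ↦ s log s`
and the probability measure `c w² dV` (both reused from the two-piece file).
References: Cycon–Froese–Kirsch–Simon, *Schrödinger Operators* (1987), Thm. 3.2 (IMS localisation
formula); Perelman 2002, §3. Everything is proved; no definitions, no named facts.
-/

noncomputable section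

-- the registered namespace `Summit.SmoothPoincare4.SmoothPoincare4.Theorems` repeats a component
set_option linter.dupNamespace false

open scoped Manifold ContDiff Topology ENNReal NNReal
open Set Filter MeasureTheory
open Literature.Geometry.Lorentzian Literature.Geometry.Riemannian

namespace Summit.SmoothPoincare4.SmoothPoincare4.Theorems

namespace EntropyLocalisationFinite

variable {M : Type} [TopologicalSpace M]
  [ChartedSpace (EuclideanSpace ℝ (Fin 4)) M] [IsManifold (𝓡 4) ∞ M]
  (g : PseudoRiemannianMetric (𝓡 4) ∞ (EuclideanSpace ℝ (Fin 4)) (TangentSpace (𝓡 4) : M → Type _))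

/-! ### Pointwise identities -/

omit [IsManifold (𝓡 4) ∞ M] in
/-- If `Σᵢ χᵢ² = 1` for a finite family then `Σᵢ χᵢ dχᵢ = 0` (differentiate the identity). -/
theorem dcov_partition_sum {n : ℕ} {χ : Fin n → M → ℝ} (h1 : ∀ y, ∑ i, χ i y ^ 2 = 1) {x : M}
    (hχ : ∀ i, MDifferentiableAt (𝓡 4) 𝓘(ℝ, ℝ) (χ i) x) :
    ∑ i, χ i x • mvfderiv (𝓡 4) (χ i) x = 0 := by
  have hsum := (mvfderiv_finset_sum (I := 𝓡 4) Finset.univ (F := fun i y ↦ χ i y * χ i y)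
    (p := x) (fun i _ ↦ (hχ i).mul (hχ i))).2
  have hfun : (fun y ↦ ∑ i, χ i y * χ i y) = fun _ ↦ (1 : ℝ) := by
    funext y
    rw [← h1 y]
    exact Finset.sum_congr rfl fun i _ ↦ by ring
  have hd : mvfderiv (𝓡 4) (fun y ↦ ∑ i, χ i y * χ i y) x = 0 := by
    rw [hfun, mvfderiv_const]
  have hterm : ∀ i, mvfderiv (𝓡 4) (fun y ↦ χ i y * χ i y) x =
      χ i x • mvfderiv (𝓡 4) (χ i) x + χ i x • mvfderiv (𝓡 4) (χ i) x :=
    fun i ↦ mvfderiv_fun_mul (hχ i) (hχ i)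
  rw [hsum] at hd
  simp only [hterm, Finset.sum_add_distrib] at hd
  have h2 : (2 : ℝ) • ∑ i, χ i x • mvfderiv (𝓡 4) (χ i) x = 0 := by
    rw [two_smul]
    exact hd
  exact (smul_eq_zero.mp h2).resolve_left two_ne_zero

/-- **IMS localisation formula** (finitely many pieces): if `Σᵢ χᵢ² = 1` then
`Σᵢ |∇(χᵢ w)|² = |∇w|² + w² Σᵢ |∇χᵢ|²`. Cycon–Froese–Kirsch–Simon 1987, Thm. 3.2. -/
theorem gradSq_localisation_sum {n : ℕ} {χ : Fin n → M → ℝ} {w : M → ℝ}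
    (h1 : ∀ y, ∑ i, χ i y ^ 2 = 1) {x : M}
    (hχ : ∀ i, MDifferentiableAt (𝓡 4) 𝓘(ℝ, ℝ) (χ i) x)
    (hw : MDifferentiableAt (𝓡 4) 𝓘(ℝ, ℝ) w x) :
    ∑ i, g.gradSq (fun y ↦ χ i y * w y) x =
      g.gradSq w x + w x ^ 2 * ∑ i, g.gradSq (χ i) x := by
  have hexp : ∀ i, g.gradSq (fun y ↦ χ i y * w y) x =
      χ i x ^ 2 * g.gradSq w x + 2 * (χ i x * w x) *
        g.innerDual x ((mvfderiv (𝓡 4) (χ i) x : TangentSpace (𝓡 4) x →ₗ[ℝ] ℝ))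
          ((mvfderiv (𝓡 4) w x : TangentSpace (𝓡 4) x →ₗ[ℝ] ℝ))
        + w x ^ 2 * g.gradSq (χ i) x :=
    fun i ↦ EntropyLocalisation.gradSq_mul g (hχ i) hw
  simp only [hexp, Finset.sum_add_distrib]
  have hA : ∑ i, χ i x ^ 2 * g.gradSq w x = g.gradSq w x := by
    rw [← Finset.sum_mul, h1 x, one_mul]
  have hC : ∑ i, w x ^ 2 * g.gradSq (χ i) x = w x ^ 2 * ∑ i, g.gradSq (χ i) x := by
    rw [Finset.mul_sum]
  have h0 : ∑ i, χ i x *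
      g.innerDual x ((mvfderiv (𝓡 4) (χ i) x : TangentSpace (𝓡 4) x →ₗ[ℝ] ℝ))
        ((mvfderiv (𝓡 4) w x : TangentSpace (𝓡 4) x →ₗ[ℝ] ℝ)) = 0 := by
    have hP := dcov_partition_sum h1 hχ
    have hP' := congrArg (fun L : TangentSpace (𝓡 4) x →L[ℝ] ℝ ↦
      g.innerDual x (L : TangentSpace (𝓡 4) x →ₗ[ℝ] ℝ)
        ((mvfderiv (𝓡 4) w x : TangentSpace (𝓡 4) x →ₗ[ℝ] ℝ))) hP
    simp only [ContinuousLinearMap.toLinearMap_sum, ContinuousLinearMap.toLinearMap_smul,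
      ContinuousLinearMap.toLinearMap_zero] at hP'
    simp only [PseudoRiemannianMetric.innerDual, LinearMap.sum_apply, LinearMap.smul_apply,
      LinearMap.zero_apply, smul_eq_mul] at hP'
    simpa only [PseudoRiemannianMetric.innerDual] using hP'
  have hcross : ∑ i, 2 * (χ i x * w x) *
      g.innerDual x ((mvfderiv (𝓡 4) (χ i) x : TangentSpace (𝓡 4) x →ₗ[ℝ] ℝ))
        ((mvfderiv (𝓡 4) w x : TangentSpace (𝓡 4) x →ₗ[ℝ] ℝ)) = 0 := by
    have : ∑ i, 2 * (χ i x * w x) *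
        g.innerDual x ((mvfderiv (𝓡 4) (χ i) x : TangentSpace (𝓡 4) x →ₗ[ℝ] ℝ))
          ((mvfderiv (𝓡 4) w x : TangentSpace (𝓡 4) x →ₗ[ℝ] ℝ))
        = 2 * w x * ∑ i, χ i x *
          g.innerDual x ((mvfderiv (𝓡 4) (χ i) x : TangentSpace (𝓡 4) x →ₗ[ℝ] ℝ))
            ((mvfderiv (𝓡 4) w x : TangentSpace (𝓡 4) x →ₗ[ℝ] ℝ)) := by
      rw [Finset.mul_sum]
      exact Finset.sum_congr rfl fun i _ ↦ by ring
    rw [this, h0, mul_zero]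
  rw [hA, hcross, hC, add_zero]

/-- Pointwise identity of the `𝒲`-densities under a finite partition `Σᵢ χᵢ² = 1`:
`Σᵢ 𝓌(χᵢ w) c = 𝓌(w) c + 4τ c w² Σᵢ|∇χᵢ|² − Σᵢ c w² χᵢ² log χᵢ²`. -/
theorem wDensity_localisation_sum [g.HasLeviCivita] {n : ℕ} {χ : Fin n → M → ℝ} {w : M → ℝ}
    (h1 : ∀ y, ∑ i, χ i y ^ 2 = 1) {x : M}
    (hχ : ∀ i, MDifferentiableAt (𝓡 4) 𝓘(ℝ, ℝ) (χ i) x)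
    (hw : MDifferentiableAt (𝓡 4) 𝓘(ℝ, ℝ) w x) (τ c : ℝ) :
    ∑ i, (τ * (g.scalarCurvature x * (χ i x * w x) ^ 2 + 4 * g.gradSq (fun y ↦ χ i y * w y) x)
        - (χ i x * w x) ^ 2 * Real.log ((χ i x * w x) ^ 2) - 4 * (χ i x * w x) ^ 2) * c
      = (τ * (g.scalarCurvature x * w x ^ 2 + 4 * g.gradSq w x)
          - w x ^ 2 * Real.log (w x ^ 2) - 4 * w x ^ 2) * c
        + 4 * τ * (c * w x ^ 2 * ∑ i, g.gradSq (χ i) x)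
        - ∑ i, c * w x ^ 2 * (χ i x ^ 2 * Real.log (χ i x ^ 2)) := by
  -- rewrite each summand as `χᵢ² K + 4τc |∇(χᵢw)|² − c w² χᵢ² log χᵢ²`
  set K : ℝ := c * (τ * g.scalarCurvature x * w x ^ 2 - w x ^ 2 * Real.log (w x ^ 2)
    - 4 * w x ^ 2) with hK
  have hterm : ∀ i,
      (τ * (g.scalarCurvature x * (χ i x * w x) ^ 2 + 4 * g.gradSq (fun y ↦ χ i y * w y) x)
        - (χ i x * w x) ^ 2 * Real.log ((χ i x * w x) ^ 2) - 4 * (χ i x * w x) ^ 2) * c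
      = χ i x ^ 2 * K + 4 * τ * c * g.gradSq (fun y ↦ χ i y * w y) x
        - c * w x ^ 2 * (χ i x ^ 2 * Real.log (χ i x ^ 2)) := by
    intro i
    rw [EntropyLocalisation.sq_mul_log_sq_mul (χ i x) (w x), hK]
    ring
  simp only [hterm, Finset.sum_sub_distrib, Finset.sum_add_distrib]
  rw [← Finset.sum_mul, h1 x, one_mul, ← Finset.mul_sum, gradSq_localisation_sum g h1 hχ hw, hK]
  ring

/-! ### The integrated inequality -/

section Integral

variable [CompactSpace M] [T3Space M] [MeasurableSpace M] [BorelSpace M]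

/-- **Localisation inequality for Perelman's `𝒲`-functional (finitely many pieces), internal
form.** On a closed Riemannian 4-manifold, for `τ > 0`, `c = (4πτ)⁻²`, smooth `χᵢ` (`i < n`) with
`Σᵢ χᵢ² = 1` and a smooth `w` with `∫ c w² dV = 1`:
`Σᵢ 𝒲(χᵢ w) + Σᵢ mᵢ log mᵢ − 4τ ∫ c w² (Σᵢ |∇χᵢ|²) dV ≤ 𝒲(w)`, `mᵢ = ∫ c w² χᵢ² dV`.
IMS localisation (Cycon–Froese–Kirsch–Simon 1987, Thm. 3.2) + Jensen for `s log s`. -/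
theorem wEntropy_localisation_sum' [g.HasLeviCivita] (hg : g.IsRiemannian) {τ : ℝ} (hτ : 0 < τ)
    {n : ℕ} {χ : Fin n → M → ℝ} {w : M → ℝ}
    (hχ : ∀ i, ContMDiff (𝓡 4) 𝓘(ℝ, ℝ) ∞ (χ i)) (hw : ContMDiff (𝓡 4) 𝓘(ℝ, ℝ) ∞ w)
    (h1 : ∀ y, ∑ i, χ i y ^ 2 = 1)
    (hnorm : ∫ x, (4 * Real.pi * τ) ^ (-(4 : ℝ) / 2) * w x ^ 2
      ∂(riemannianMeasure (g.toContMDiffRiemannianMetric hg)) = 1) :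
    (∑ i, ∫ x, (τ * (g.scalarCurvature x * (χ i x * w x) ^ 2
            + 4 * g.gradSq (fun y ↦ χ i y * w y) x)
          - (χ i x * w x) ^ 2 * Real.log ((χ i x * w x) ^ 2) - 4 * (χ i x * w x) ^ 2)
          * (4 * Real.pi * τ) ^ (-(4 : ℝ) / 2) ∂(riemannianMeasure (g.toContMDiffRiemannianMetric hg)))
      + (∑ i, (∫ x, (4 * Real.pi * τ) ^ (-(4 : ℝ) / 2) * w x ^ 2 * χ i x ^ 2
            ∂(riemannianMeasure (g.toContMDiffRiemannianMetric hg))) *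
          Real.log (∫ x, (4 * Real.pi * τ) ^ (-(4 : ℝ) / 2) * w x ^ 2 * χ i x ^ 2
            ∂(riemannianMeasure (g.toContMDiffRiemannianMetric hg))))
      - 4 * τ * ∫ x, (4 * Real.pi * τ) ^ (-(4 : ℝ) / 2) * w x ^ 2 * (∑ i, g.gradSq (χ i) x)
            ∂(riemannianMeasure (g.toContMDiffRiemannianMetric hg))
      ≤ ∫ x, (τ * (g.scalarCurvature x * w x ^ 2 + 4 * g.gradSq w x)
          - w x ^ 2 * Real.log (w x ^ 2) - 4 * w x ^ 2) * (4 * Real.pi * τ) ^ (-(4 : ℝ) / 2)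
          ∂(riemannianMeasure (g.toContMDiffRiemannianMetric hg)) := by
  set μ : Measure M := riemannianMeasure (g.toContMDiffRiemannianMetric hg) with hμ
  set c : ℝ := (4 * Real.pi * τ) ^ (-(4 : ℝ) / 2) with hc
  have hc0 : 0 ≤ c := Real.rpow_nonneg (by positivity) _
  -- smoothness / continuity of the pieces
  have hwi : ∀ i, ContMDiff (𝓡 4) 𝓘(ℝ, ℝ) ∞ (fun y ↦ χ i y * w y) := fun i ↦ (hχ i).mul hw
  have hwc : Continuous w := hw.continuous
  have hχc : ∀ i, Continuous (χ i) := fun i ↦ (hχ i).continuous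
  have hG : ∀ i, Continuous (g.gradSq (χ i)) := fun i ↦ (contMDiff_gradSq g (hχ i)).continuous
  have hGs : Continuous fun x ↦ ∑ i, g.gradSq (χ i) x :=
    continuous_finsetSum _ fun i _ ↦ hG i
  -- the pointwise identity of the densities
  have hpt : ∀ x,
      ∑ i, (τ * (g.scalarCurvature x * (χ i x * w x) ^ 2 + 4 * g.gradSq (fun y ↦ χ i y * w y) x)
          - (χ i x * w x) ^ 2 * Real.log ((χ i x * w x) ^ 2) - 4 * (χ i x * w x) ^ 2) * c
      = (τ * (g.scalarCurvature x * w x ^ 2 + 4 * g.gradSq w x)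
          - w x ^ 2 * Real.log (w x ^ 2) - 4 * w x ^ 2) * c
        + 4 * τ * (c * w x ^ 2 * ∑ i, g.gradSq (χ i) x)
        - ∑ i, c * w x ^ 2 * (χ i x ^ 2 * Real.log (χ i x ^ 2)) :=
    fun x ↦ wDensity_localisation_sum g h1 (fun i ↦ (hχ i x).mdifferentiableAt (by simp))
      ((hw x).mdifferentiableAt (by simp)) τ c
  -- integrability
  have hI : ∀ i, Integrable (fun x ↦ (τ * (g.scalarCurvature x * (χ i x * w x) ^ 2
        + 4 * g.gradSq (fun y ↦ χ i y * w y) x)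
      - (χ i x * w x) ^ 2 * Real.log ((χ i x * w x) ^ 2) - 4 * (χ i x * w x) ^ 2) * c) μ :=
    fun i ↦ EntropyLocalisation.integrable_of_continuous g hg
      (EntropyLocalisation.continuous_wDensity g (hwi i) τ c)
  have hIw : Integrable (fun x ↦ (τ * (g.scalarCurvature x * w x ^ 2 + 4 * g.gradSq w x)
      - w x ^ 2 * Real.log (w x ^ 2) - 4 * w x ^ 2) * c) μ :=
    EntropyLocalisation.integrable_of_continuous g hg
      (EntropyLocalisation.continuous_wDensity g hw τ c)
  have hcw : Continuous fun x ↦ c * w x ^ 2 := continuous_const.mul (hwc.pow 2)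
  have hIG : Integrable (fun x ↦ c * w x ^ 2 * ∑ i, g.gradSq (χ i) x) μ :=
    EntropyLocalisation.integrable_of_continuous g hg (hcw.mul hGs)
  have hIL : ∀ i, Integrable (fun x ↦ c * w x ^ 2 * (χ i x ^ 2 * Real.log (χ i x ^ 2))) μ :=
    fun i ↦ EntropyLocalisation.integrable_of_continuous g hg
      (hcw.mul (Real.continuous_mul_log.comp ((hχc i).pow 2)))
  have hILs : Integrable (fun x ↦ ∑ i, c * w x ^ 2 * (χ i x ^ 2 * Real.log (χ i x ^ 2))) μ :=
    integrable_finsetSum _ fun i _ ↦ hIL i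
  -- integrate the pointwise identity
  have hsum : (∑ i, ∫ x, (τ * (g.scalarCurvature x * (χ i x * w x) ^ 2
            + 4 * g.gradSq (fun y ↦ χ i y * w y) x)
          - (χ i x * w x) ^ 2 * Real.log ((χ i x * w x) ^ 2) - 4 * (χ i x * w x) ^ 2) * c ∂μ)
      = (∫ x, (τ * (g.scalarCurvature x * w x ^ 2 + 4 * g.gradSq w x)
          - w x ^ 2 * Real.log (w x ^ 2) - 4 * w x ^ 2) * c ∂μ)
        + 4 * τ * (∫ x, c * w x ^ 2 * (∑ i, g.gradSq (χ i) x) ∂μ)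
        - ∑ i, ∫ x, c * w x ^ 2 * (χ i x ^ 2 * Real.log (χ i x ^ 2)) ∂μ := by
    rw [← integral_finsetSum _ fun i _ ↦ hI i, integral_congr_ae (ae_of_all _ fun x ↦ hpt x)]
    have hG4 : Integrable (fun x ↦ 4 * τ * (c * w x ^ 2 * ∑ i, g.gradSq (χ i) x)) μ :=
      hIG.const_mul (4 * τ)
    have hA : Integrable (fun x ↦ (τ * (g.scalarCurvature x * w x ^ 2 + 4 * g.gradSq w x)
          - w x ^ 2 * Real.log (w x ^ 2) - 4 * w x ^ 2) * c
          + 4 * τ * (c * w x ^ 2 * ∑ i, g.gradSq (χ i) x)) μ := hIw.add hG4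
    rw [integral_sub hA hILs, integral_add hIw hG4, integral_const_mul,
      integral_finsetSum _ fun i _ ↦ hIL i]
  -- Jensen on the mixing terms
  have hJ : ∑ i, (∫ x, c * w x ^ 2 * χ i x ^ 2 ∂μ) * Real.log (∫ x, c * w x ^ 2 * χ i x ^ 2 ∂μ)
      ≤ ∑ i, ∫ x, c * w x ^ 2 * (χ i x ^ 2 * Real.log (χ i x ^ 2)) ∂μ :=
    Finset.sum_le_sum fun i _ ↦
      EntropyLocalisation.mul_log_le_integral_of_sq_density g hg hwc (hχc i) hc0 hnorm
  linarith [hsum, hJ]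

end Integral

end EntropyLocalisationFinite

/-- **Localisation inequality for Perelman's `𝒲`-functional (finite partition), registered form**
(summit binder, explicit arguments; see `EntropyLocalisationFinite.wEntropy_localisation_sum'`):
for `τ > 0`, `c = (4πτ)⁻²`, a finite family of smooth `χᵢ` with `Σᵢ χᵢ² = 1` and a smooth `w`
with `∫ c w² dV = 1`,
`Σᵢ 𝒲(χᵢ w) + Σᵢ mᵢ log mᵢ − 4τ ∫ c w² (Σᵢ |∇χᵢ|²) dV ≤ 𝒲(w)`, `mᵢ = ∫ c w² χᵢ² dV`. Helper W5
("finite-partition IMS localisation of `𝒲`") for line `fat-conical-core-avr-logsobolev` (crux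
stmt-SmoothPoincare4-10871). Cycon–Froese–Kirsch–Simon 1987, Thm. 3.2 (IMS); Jensen. -/
theorem helper_localisationFinite :
    ∀ (M : Type) [TopologicalSpace M] [T2Space M] [SecondCountableTopology M]
      [ChartedSpace (EuclideanSpace ℝ (Fin 4)) M] [IsManifold (𝓡 4) ∞ M] [CompactSpace M]
      [T3Space M] [MeasurableSpace M] [BorelSpace M]
      (g : PseudoRiemannianMetric (𝓡 4) ∞ (EuclideanSpace ℝ (Fin 4)) (TangentSpace (𝓡 4) : M → Type _))
      [g.HasLeviCivita] (hg : g.IsRiemannian) (τ : ℝ), 0 < τ → ∀ (n : ℕ) (χ : Fin n → M → ℝ) (w : M → ℝ),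
      (∀ i, ContMDiff (𝓡 4) 𝓘(ℝ, ℝ) ∞ (χ i)) → ContMDiff (𝓡 4) 𝓘(ℝ, ℝ) ∞ w →
      (∀ y, ∑ i, χ i y ^ 2 = 1) →
      ∫ x, (4 * Real.pi * τ) ^ (-(4 : ℝ) / 2) * w x ^ 2
        ∂(riemannianMeasure (g.toContMDiffRiemannianMetric hg)) = 1 →
      (∑ i, ∫ x, (τ * (g.scalarCurvature x * (χ i x * w x) ^ 2 + 4 * g.gradSq (fun y ↦ χ i y * w y) x)
            - (χ i x * w x) ^ 2 * Real.log ((χ i x * w x) ^ 2) - 4 * (χ i x * w x) ^ 2)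
            * (4 * Real.pi * τ) ^ (-(4 : ℝ) / 2) ∂(riemannianMeasure (g.toContMDiffRiemannianMetric hg)))
        + (∑ i, (∫ x, (4 * Real.pi * τ) ^ (-(4 : ℝ) / 2) * w x ^ 2 * χ i x ^ 2
              ∂(riemannianMeasure (g.toContMDiffRiemannianMetric hg))) *
            Real.log (∫ x, (4 * Real.pi * τ) ^ (-(4 : ℝ) / 2) * w x ^ 2 * χ i x ^ 2
              ∂(riemannianMeasure (g.toContMDiffRiemannianMetric hg))))
        - 4 * τ * ∫ x, (4 * Real.pi * τ) ^ (-(4 : ℝ) / 2) * w x ^ 2 * (∑ i, g.gradSq (χ i) x)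
              ∂(riemannianMeasure (g.toContMDiffRiemannianMetric hg))
        ≤ ∫ x, (τ * (g.scalarCurvature x * w x ^ 2 + 4 * g.gradSq w x)
            - w x ^ 2 * Real.log (w x ^ 2) - 4 * w x ^ 2) * (4 * Real.pi * τ) ^ (-(4 : ℝ) / 2)
            ∂(riemannianMeasure (g.toContMDiffRiemannianMetric hg)) := by
  intro M _ _ _ _ _ _ _ _ _ g _ hg τ hτ n χ w hχ hw h1 hnorm
  exact EntropyLocalisationFinite.wEntropy_localisation_sum' g hg hτ hχ hw h1 hnorm

end Summit.SmoothPoincare4.SmoothPoincare4.Theorems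

end
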